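import Literature.Topology.FourManifolds.CorkDecompositionMiddleLevel
import HarnessLib

/-!
# The cork decomposition theorem from handle trading, (B) and (H4) (assembly)

Topic `Literature/Topology/FourManifolds` (fact item `provefact-Literature.corkDecomposition`). One
theorem, joining the halves of the DAG of the cork decomposition theorem
`Literature.Topology.FourManifolds.corkDecomposition` (`CorkTwist.lean`; Curtis–Freedman–Hsiang–Stong 1996, Matveyev 1996)
along the first sentence of its printed proofs (Matveyev, Proof of Theorem: *"First, observe
that `U` has a handlebody with no 1- and 4-handles. Let `N` be the middle level of `U` between
2- and 3-handles"*; Kirby §2):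

* `Literature.Topology.FourManifolds.corkDecomposition_of_partOne_and_fact` (`SeamAdaptedWitnesses.lean`): everything in Matveyev's
  proof from part 1 + "Fact 1" on (fig. 2, boundary connected sums, `X # S⁴ ≅ X`, collars, seam
  adaptation) is proved, so `Matveyev1996_partOne_and_fact → corkDecomposition`;
* the handle-trading fact (K1) `Literature.Topology.FourManifolds.exists_isMorseFunction_two_three_of_isHCobordism`
  (`HCobordismHandles.lean`; Milnor 1965 §8, Freedman–Quinn 1990 proof of Thm. 7.1D, shared
  with the DAG of Freedman's theorem `HCobordismFreedman.lean`): the h-cobordism carries a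
  Morse function with only index-2 critical points below `1/2` and index-3 critical points
  above;
* from such a handlebody on, the middle level (B)
  `Literature.Topology.FourManifolds.exists_dualSpheres_middleLevel_of_two_three` and the
  four-dimensional construction in it (H4)
  `Literature.Topology.FourManifolds.Matveyev1996_partOne_and_fact_of_dualSpheres`
  (`CorkDecompositionMiddleLevel.lean`; Casson-type finger and Whitney moves, surgery, Kirby
  calculus — Matveyev pp. 1–3, Kirby §§3–4), joined by
  `Matveyev1996_partOne_and_fact_of_dualSpheres.apply_two_three`.

Hence `Literature.Topology.FourManifolds.corkDecomposition_of_two_three`: **`corkDecomposition` follows from (K1), (B) and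
(H4)**.  (K1) is meanwhile a theorem of the tree
(`exists_isMorseFunction_two_three_of_isHCobordism_holds`, `HCobordismHandlesProofs.lean`), so
the live frontier is (B) ∧ (H4) (`CorkDecompositionProofs.lean`); this file is kept for the
record.

**Merge of the handlebody form (2026-08-15, D-0026 review).**  `corkDecomposition_of_two_three`
used to take, in place of (B) and (H4), the intermediate named fact
`Matveyev1996_partOne_and_fact_of_two_three` of `CorkDecompositionHandlebody.lean` ("the
handlebody form": `Matveyev1996_partOne_and_fact` with the output of (K1) as an extra
hypothesis).  With (K1) discharged that fact had become unconditionally equivalent to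
`Matveyev1996_partOne_and_fact` — one proof obligation counted twice — and the D-0026 review
merged it back into its parent; its split (B) ∧ (H4) takes its place here.

## References

* R. Matveyev, *A decomposition of smooth simply-connected h-cobordant 4-manifolds*,
  J. Differential Geom. 44 (1996) 571–582; arXiv:dg-ga/9505001, Theorem 1 and its proof.
  [Matveyev1996]
* R. Kirby, *Akbulut's corks and h-cobordisms of smooth, simply connected 4-manifolds*, Turkish
  J. Math. 20 (1996) 85–93; arXiv:math/9712231, §§2–5. [KirbyCorks1996]
* M. H. Freedman, F. Quinn, *Topology of 4-manifolds*, Princeton (1990), proof of Thm. 7.1D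
  (p. 85). [FreedmanQuinnPMS1990]
-/

noncomputable section

namespace Literature.Topology.FourManifolds

universe u

/-- **The cork decomposition theorem from handle trading, (B) and (H4).**
`Literature.Topology.FourManifolds.corkDecomposition` (h-cobordant simply connected closed smooth
4-manifolds differ by a cork twist along a compact contractible `C`; Curtis–Freedman–Hsiang–Stong
1996, Matveyev 1996) follows from the named facts
`Literature.Topology.FourManifolds.exists_isMorseFunction_two_three_of_isHCobordism` (Smale–Milnor handle trading in the
5-dimensional h-cobordism: only 2-handles below and 3-handles above the middle level — the
first sentence of the printed proofs),
`Literature.Topology.FourManifolds.exists_dualSpheres_middleLevel_of_two_three` (B: the middle level of that handlebody) and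
`Literature.Topology.FourManifolds.Matveyev1996_partOne_and_fact_of_dualSpheres` (H4: the middle-level construction and Kirby
calculus), everything else — Matveyev's fig. 2, boundary connected sums, `X # S⁴ ≅ X`, collars
and seam adaptation — being proved in the tree (`corkDecomposition_of_partOne_and_fact`).
[cite: Matveyev1996, Theorem 1 and its proof (arXiv pp. 1–3)]
[cite: KirbyCorks1996, §2 and §§3–4] [cite: FreedmanQuinnPMS1990, proof of Thm. 7.1D (p. 85)] -/
theorem corkDecomposition_of_two_three
    (h₁ : exists_isMorseFunction_two_three_of_isHCobordism.{u})
    (hB : exists_dualSpheres_middleLevel_of_two_three.{u})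
    (h4 : Matveyev1996_partOne_and_fact_of_dualSpheres.{u}) : corkDecomposition.{u} := by
  refine corkDecomposition_of_partOne_and_fact ?_
  intro X₁ X₂ _ _ _ _ _ _ _ _ _ _ _ _ _ _ hcob
  obtain ⟨c, hc⟩ := hcob
  obtain ⟨f, hf, hind, -⟩ := h₁ X₁ X₂ c hc
  exact h4.apply_two_three hB c f hc hf hind

end Literature.Topology.FourManifolds

end
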